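import Mathlib.NumberTheory.ModularForms.Cusps
import Mathlib.NumberTheory.ModularForms.ProperlyDiscontinuous
import Literature.AnabelianGeometry.AbsoluteAnabelian.ArchimedeanHolFieldFunctorGeometricPSLNormalizerFiniteCuspedSubgroup
import HarnessLib

/-!
# (P), (FC), `[N(Γ̄) : Γ̄] < ∞` and proper discontinuity for every ARITHMETIC `Γ̄ ≤ PSL₂(ℝ)` (PROOF-ONLY)

abc-iut cell, LINEAGE ROW «J2i-GAMMA2-MODEL» part 2 (GO abc-iut-L4-lead m61/m63), seat abc-iut-L4-d1,
GENERALISED from `Γ̄(2)` to all arithmetic groups.  S. Mochizuki, *Topics in Absolute Anabelian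
Geometry III*, proof of Prop. 4.2 (i) p. 106: over a hyperbolic curve the RC/holomorphic automorphisms
of the finite étale localisations form finite groups `N_{PSL₂(ℝ)}(Λ̄)/Λ̄` — abc-iut-L4-d1's
`finiteIndex_subgroupOf_normalizer_of_cusps` (`…PSLNormalizerFiniteCusped.lean`) proves this for a
properly discontinuous non-abelian `Γ̄` GRANTED the cusp data (P) «`Γ̄` has a parabolic» and (FC)
«finitely many `Γ̄`-classes of cusps», typed linear-algebraically (eigenlines of parabolic lifts in
`SL(2, ℝ)`).  Here (P) and (FC) are DISCHARGED for every `Γ̄` whose lift `toGL(π⁻¹ Γ̄) ≤ GL(2, ℝ)` is an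
ARITHMETIC subgroup (Mathlib `Subgroup.IsArithmetic`: commensurable with `SL(2, ℤ)`; the class binder is
byte-identical to abc-iut-L4-t12's `…PSLArithmeticHfin.lean`, whose `isArithmetic_map_comap_of_subgroup_SL2Z`
supplies it for `Γ̄ = π(Λ)`, `Λ ≤ SL(2, ℤ)` of finite index — in particular `Γ̄(2) = π(Γ(2))`), from
Mathlib's theory of cusps of arithmetic groups (`Mathlib/NumberTheory/ModularForms/Cusps.lean`: the cusps
of an arithmetic group are `ℙ¹(ℚ)`, `Subgroup.IsArithmetic.isCusp_iff_isCusp_SL2Z`; finitely many cusp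
orbits, `Finite (CuspOrbits 𝒢)`) through the dictionary «eigenline `ℝ v` ↔ point `[v] ∈ ℙ¹(ℝ)`»
(Mathlib `OnePoint.equivProjectivization`, `GL(2, ℝ)`-equivariant):

* §1 `toGL_smul_equivProjectivization_symm_mk` (`toGL s • [v] = [s v]`),
  `equivProjectivization_symm_mk_eq_iff` (`[v] = [w] ↔ v ∈ ℝ w`), `toGL_smul_eq_self_of_mulVec_eq_smul`
  (eigenvector ⇒ fixed point);
* §2 ★ `exists_parabolic_of_isArithmetic` = (P), ★ `exists_finset_cusps_of_isArithmetic` = (FC), in the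
  exact binder shapes of `finiteIndex_subgroupOf_normalizer_of_cusps`;
* §3 ★ `finiteIndex_subgroupOf_normalizer_of_isArithmetic` — `[N(Γ̄) : Γ̄] < ∞` for every non-abelian
  arithmetic `Γ̄` acting properly discontinuously — and ★ `finiteIndex_subgroupOf_normalizer_of_isArithmetic_of_le`
  — the same for every non-abelian finite-index `Λ̄ ≤ Γ̄` (the `hN` binder of abc-iut-L4-t14's closers
  at every object of `Loc(PSL₂(ℝ), Γ̄)`);
* §4 ★ `properlyDiscontinuousSMul_of_isArithmetic` — every arithmetic `Γ̄` acts properly discontinuously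
  on `ℍ` (Mathlib `Subgroup.IsArithmetic.properlyDiscontinuous` pushed through `π`), with the bookkeeping
  `sl_smul_eq_toGL_smul`.

No definitions, no instances, no named facts.  HONEST FRAMING: classical (Shimura §1.3–1.5); MODEL side
of [AbsTopIII] §4 — model ≠ reconstruction; nothing here bears on the disputed [IUTchIII] Cor. 3.12.

## References

* S. Mochizuki, *Topics in Absolute Anabelian Geometry III* (2015), proof of Prop. 4.2 (i) p. 106.
  [MochizukiAbsTopIII2015]
* G. Shimura, *Introduction to the Arithmetic Theory of Automorphic Functions* (1971), §1.3–§1.5.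
  [Shimura1971]
* H. M. Farkas, I. Kra, *Riemann Surfaces*, 2nd ed. (1992), IV.5.6. [FarkasKra1992]
-/

set_option autoImplicit false

noncomputable section

open scoped UpperHalfPlane MatrixGroups Matrix Topology Pointwise
open _root_.MulAction
open Matrix.SpecialLinearGroup (toGL)

namespace Literature.AnabelianGeometry.AbsoluteAnabelian

namespace HolRS

/-! ### §1 The dictionary: eigenlines `ℝ v ⊂ ℝ²` ↔ points of `ℙ¹(ℝ) = OnePoint ℝ` -/

/-- `s v ≠ 0` for `s ∈ SL(2, ℝ)`, `v ≠ 0`. [cite: FarkasKra1992, IV.5.6] -/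
private theorem sl_mulVec_ne_zero (s : SL(2, ℝ)) {v : Fin 2 → ℝ} (hv : v ≠ 0) :
    (s : Matrix (Fin 2) (Fin 2) ℝ) *ᵥ v ≠ 0 := by
  intro h
  apply hv
  have h1 := congrArg (fun w => ((s⁻¹ : SL(2, ℝ)) : Matrix (Fin 2) (Fin 2) ℝ) *ᵥ w) h
  simp only [Matrix.mulVec_mulVec, Matrix.mulVec_zero] at h1
  rwa [← Matrix.SpecialLinearGroup.coe_mul, inv_mul_cancel, Matrix.SpecialLinearGroup.coe_one,
    Matrix.one_mulVec] at h1

/-- **Equivariance of the dictionary**: `toGL s` moves the point `[v] ∈ ℙ¹(ℝ)` of the line `ℝ v` to the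
point `[s v]` (Mathlib's `OnePoint ℝ ≃ ℙ ℝ (Fin 2 → ℝ)` is `GL(2, ℝ)`-equivariant).
[cite: Shimura1971, §1.3] -/
theorem toGL_smul_equivProjectivization_symm_mk (s : SL(2, ℝ)) {v : Fin 2 → ℝ} (hv : v ≠ 0) :
    (toGL s : GL (Fin 2) ℝ) • (OnePoint.equivProjectivization ℝ).symm (Projectivization.mk ℝ v hv) =
      (OnePoint.equivProjectivization ℝ).symm
        (Projectivization.mk ℝ ((s : Matrix (Fin 2) (Fin 2) ℝ) *ᵥ v) (sl_mulVec_ne_zero s hv)) := by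
  apply (OnePoint.equivProjectivization ℝ).injective
  rw [OnePoint.equivProjectivization_smul, Equiv.apply_symm_apply, Equiv.apply_symm_apply,
    Projectivization.smul_mk]
  congr 1

/-- Two non-zero vectors give the same point of `ℙ¹(ℝ)` iff they are proportional.
[cite: Shimura1971, §1.3] -/
theorem equivProjectivization_symm_mk_eq_iff {v w : Fin 2 → ℝ} (hv : v ≠ 0) (hw : w ≠ 0) :
    (OnePoint.equivProjectivization ℝ).symm (Projectivization.mk ℝ v hv) =
      (OnePoint.equivProjectivization ℝ).symm (Projectivization.mk ℝ w hw) ↔ ∃ a : ℝ, a • w = v := by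
  rw [(OnePoint.equivProjectivization ℝ).symm.injective.eq_iff, Projectivization.mk_eq_mk_iff']

/-- Every point of `ℙ¹(ℝ)` is the point of some line `ℝ v`, `v ≠ 0`. [cite: Shimura1971, §1.3] -/
theorem exists_equivProjectivization_symm_mk_eq (c : OnePoint ℝ) :
    (OnePoint.equivProjectivization ℝ).symm (Projectivization.mk ℝ
      (OnePoint.equivProjectivization ℝ c).rep (Projectivization.rep_nonzero _)) = c := by
  rw [Projectivization.mk_rep, Equiv.symm_apply_apply]

/-- An eigenvector `v` of `s ∈ SL(2, ℝ)` gives a fixed point `[v]` of `toGL s` on `ℙ¹(ℝ)`.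
[cite: Shimura1971, §1.3] -/
theorem toGL_smul_eq_self_of_mulVec_eq_smul (s : SL(2, ℝ)) {v : Fin 2 → ℝ} (hv : v ≠ 0) {c : ℝ}
    (h : (s : Matrix (Fin 2) (Fin 2) ℝ) *ᵥ v = c • v) :
    (toGL s : GL (Fin 2) ℝ) • (OnePoint.equivProjectivization ℝ).symm (Projectivization.mk ℝ v hv) =
      (OnePoint.equivProjectivization ℝ).symm (Projectivization.mk ℝ v hv) := by
  rw [toGL_smul_equivProjectivization_symm_mk, equivProjectivization_symm_mk_eq_iff]
  exact ⟨c, h.symm⟩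

/-! ### §2 (P) and (FC) for arithmetic `Γ̄` -/

variable (Γ : Subgroup PSL2R)

/-- **(P) for arithmetic `Γ̄`**: if `toGL(π⁻¹ Γ̄) ≤ GL(2, ℝ)` is an arithmetic subgroup, some lift
`t ∈ π⁻¹ Γ̄` is parabolic — `∞` is a cusp of every arithmetic group (Mathlib
`Subgroup.IsArithmetic.isCusp_iff_isCusp_SL2Z`). [cite: Shimura1971, §1.5]
[cite: MochizukiAbsTopIII2015, Proposition 4.2 (i) proof p.106] -/
theorem exists_parabolic_of_isArithmetic
    [hA : ((Γ.comap (QuotientGroup.mk' (Subgroup.center SL(2, ℝ)))).map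
      (toGL : SL(2, ℝ) →* GL (Fin 2) ℝ)).IsArithmetic] :
    ∃ t : SL(2, ℝ), QuotientGroup.mk' (Subgroup.center SL(2, ℝ)) t ∈ Γ ∧
      (t : Matrix (Fin 2) (Fin 2) ℝ).IsParabolic := by
  have hcusp : IsCusp (OnePoint.infty : OnePoint ℝ) ((Γ.comap (QuotientGroup.mk' (Subgroup.center SL(2, ℝ)))).map
      (toGL : SL(2, ℝ) →* GL (Fin 2) ℝ)) := by
    rw [Subgroup.IsArithmetic.isCusp_iff_isCusp_SL2Z, isCusp_SL2Z_iff']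
    exact ⟨1, by rw [map_one, one_smul]⟩
  obtain ⟨G, hG, hpar, -⟩ := hcusp
  obtain ⟨t, ht, rfl⟩ := Subgroup.mem_map.mp hG
  exact ⟨t, ht, hpar⟩

/-- **(FC) for arithmetic `Γ̄`** — finitely many `Γ̄`-classes of cusps, in the linear-algebra currency of
`finiteIndex_subgroupOf_normalizer_of_cusps`: there is a finite set `F ⊆ ℝ²` such that every
eigenvector `v ≠ 0` of every parabolic lift `t ∈ π⁻¹ Γ̄` is moved by some lift `g ∈ π⁻¹ Γ̄` onto a
multiple of a member of `F`.  From Mathlib's finiteness of cusp orbits of arithmetic groups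
(`Finite (CuspOrbits 𝒢)`) through the dictionary of §1. [cite: Shimura1971, §1.5]
[cite: MochizukiAbsTopIII2015, Proposition 4.2 (i) proof p.106] -/
theorem exists_finset_cusps_of_isArithmetic
    [hA : ((Γ.comap (QuotientGroup.mk' (Subgroup.center SL(2, ℝ)))).map
      (toGL : SL(2, ℝ) →* GL (Fin 2) ℝ)).IsArithmetic] :
    ∃ F : Finset (Fin 2 → ℝ), ∀ t : SL(2, ℝ),
      QuotientGroup.mk' (Subgroup.center SL(2, ℝ)) t ∈ Γ → (t : Matrix (Fin 2) (Fin 2) ℝ).IsParabolic →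
      ∀ v : Fin 2 → ℝ, v ≠ 0 → (∃ c : ℝ, (t : Matrix (Fin 2) (Fin 2) ℝ) *ᵥ v = c • v) →
      ∃ g : SL(2, ℝ), QuotientGroup.mk' (Subgroup.center SL(2, ℝ)) g ∈ Γ ∧ ∃ w ∈ F, ∃ c : ℝ,
        (g : Matrix (Fin 2) (Fin 2) ℝ) *ᵥ v = c • w := by
  classical
  set A : Subgroup (GL (Fin 2) ℝ) := ((Γ.comap (QuotientGroup.mk' (Subgroup.center SL(2, ℝ)))).map
      (toGL : SL(2, ℝ) →* GL (Fin 2) ℝ)) with hA_def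
  haveI : Fintype (CuspOrbits A) := Fintype.ofFinite _
  -- one vector per cusp orbit
  let vec : CuspOrbits A → (Fin 2 → ℝ) := fun o =>
    (OnePoint.equivProjectivization ℝ ((Quotient.out o : cuspsSubMulAction A) : OnePoint ℝ)).rep
  refine ⟨Finset.univ.image vec, fun t ht hpar v hv ⟨c, hc⟩ => ?_⟩
  -- the cusp `[v]` and its orbit
  have htA : (toGL t : GL (Fin 2) ℝ) ∈ A := Subgroup.mem_map.mpr ⟨t, ht, rfl⟩
  have hcusp : IsCusp ((OnePoint.equivProjectivization ℝ).symm (Projectivization.mk ℝ v hv)) A :=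
    ⟨toGL t, htA, hpar, toGL_smul_eq_self_of_mulVec_eq_smul t hv hc⟩
  let x : cuspsSubMulAction A := ⟨(OnePoint.equivProjectivization ℝ).symm (Projectivization.mk ℝ v hv),
    hcusp⟩
  let o : CuspOrbits A := Quotient.mk (orbitRel A (cuspsSubMulAction A)) x
  have ho : (Quotient.out o : cuspsSubMulAction A) ∈ orbit A x :=
    orbitRel_apply.mp (Quotient.exact (Quotient.out_eq o))
  obtain ⟨a, ha⟩ := mem_orbit_iff.mp ho
  obtain ⟨g, hg, hga⟩ := Subgroup.mem_map.mp a.2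
  have hval : (toGL g : GL (Fin 2) ℝ) • (OnePoint.equivProjectivization ℝ).symm
      (Projectivization.mk ℝ v hv) = ((Quotient.out o : cuspsSubMulAction A) : OnePoint ℝ) := by
    rw [hga, ← ha, SubMulAction.val_smul, Subgroup.smul_def]
  refine ⟨g, hg, vec o, Finset.mem_image_of_mem vec (Finset.mem_univ o), ?_⟩
  rw [toGL_smul_equivProjectivization_symm_mk, ← exists_equivProjectivization_symm_mk_eq
    ((Quotient.out o : cuspsSubMulAction A) : OnePoint ℝ), equivProjectivization_symm_mk_eq_iff] at hval
  obtain ⟨a', ha'⟩ := hval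
  exact ⟨a', ha'.symm⟩

/-! ### §3 `[N(Γ̄) : Γ̄] < ∞` and `hN` for arithmetic `Γ̄` -/

/-- ★ **`[N_{PSL₂(ℝ)}(Γ̄) : Γ̄] < ∞` for every non-abelian ARITHMETIC `Γ̄ ≤ PSL₂(ℝ)`** acting properly
discontinuously on `ℍ` (abc-iut-L4-d1's `finiteIndex_subgroupOf_normalizer_of_cusps` with (P), (FC)
DISCHARGED). [cite: MochizukiAbsTopIII2015, Proposition 4.2 (i) proof p.106] [cite: Shimura1971, §1.5] -/
theorem finiteIndex_subgroupOf_normalizer_of_isArithmetic [ProperlyDiscontinuousSMul Γ ℍ]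
    [hA : ((Γ.comap (QuotientGroup.mk' (Subgroup.center SL(2, ℝ)))).map
      (toGL : SL(2, ℝ) →* GL (Fin 2) ℝ)).IsArithmetic]
    (hΓ : ∃ x y : Γ, x * y ≠ y * x) :
    (Γ.subgroupOf (Subgroup.normalizer (Γ : Set PSL2R))).FiniteIndex :=
  finiteIndex_subgroupOf_normalizer_of_cusps Γ hΓ (exists_parabolic_of_isArithmetic Γ)
    (exists_finset_cusps_of_isArithmetic Γ)

/-- ★ **… and for every non-abelian finite-index `Λ̄ ≤ Γ̄`** (the `hN` binder of abc-iut-L4-t14's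
closers, at every object of `Loc(PSL₂(ℝ), Γ̄)`, from the cusp data of the arithmetic `Γ̄` alone —
abc-iut-L4-d1's `finiteIndex_subgroupOf_normalizer_of_cusps_of_le`).
[cite: MochizukiAbsTopIII2015, Proposition 4.2 (i) proof p.106] [cite: Shimura1971, §1.5] -/
theorem finiteIndex_subgroupOf_normalizer_of_isArithmetic_of_le [ProperlyDiscontinuousSMul Γ ℍ]
    [hA : ((Γ.comap (QuotientGroup.mk' (Subgroup.center SL(2, ℝ)))).map
      (toGL : SL(2, ℝ) →* GL (Fin 2) ℝ)).IsArithmetic]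
    (Λ : Subgroup PSL2R) (hΛΓ : Λ ≤ Γ) [(Λ.subgroupOf Γ).FiniteIndex] (hΛ : ∃ x y : Λ, x * y ≠ y * x) :
    (Λ.subgroupOf (Subgroup.normalizer (Λ : Set PSL2R))).FiniteIndex :=
  finiteIndex_subgroupOf_normalizer_of_cusps_of_le Γ Λ hΛΓ hΛ (exists_parabolic_of_isArithmetic Γ)
    (exists_finset_cusps_of_isArithmetic Γ)

/-! ### §4 Arithmetic `Γ̄` act properly discontinuously on `ℍ` -/

/-- `mapGL ℝ t = toGL t` for `t ∈ SL(2, ℝ)` (the `ℝ`-algebra map `ℝ → ℝ` is the identity).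
[cite: FarkasKra1992, IV.5.6] -/
private theorem mapGL_real_eq_toGL (t : SL(2, ℝ)) :
    Matrix.SpecialLinearGroup.mapGL ℝ t = (toGL t : GL (Fin 2) ℝ) := by
  refine Units.ext ?_
  rw [Matrix.SpecialLinearGroup.mapGL_coe_matrix, Matrix.SpecialLinearGroup.coe_GL_coe_matrix]
  exact Matrix.map_id _

/-- The Möbius action of `t ∈ SL(2, ℝ)` on `ℍ` is that of `toGL t ∈ GL(2, ℝ)`. [cite: FarkasKra1992, IV.5.6] -/
theorem sl_smul_eq_toGL_smul (t : SL(2, ℝ)) (τ : ℍ) : t • τ = (toGL t : GL (Fin 2) ℝ) • τ := by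
  rw [← mapGL_real_eq_toGL]
  rfl

/-- ★ **Every arithmetic `Γ̄ ≤ PSL₂(ℝ)` acts properly discontinuously on `ℍ`**: Mathlib's
`Subgroup.IsArithmetic.properlyDiscontinuous` for `toGL(π⁻¹ Γ̄) ≤ GL(2, ℝ)`, pushed through the `2 : 1`
map `π : SL(2, ℝ) → PSL₂(ℝ)` (the set of `q ∈ Γ̄` moving a compact `K` into a compact `L` is the image
of the corresponding finite set of lifts). [cite: Shimura1971, §1.5] [cite: FarkasKra1992, IV.5.6] -/
theorem properlyDiscontinuousSMul_of_isArithmetic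
    [hA : ((Γ.comap (QuotientGroup.mk' (Subgroup.center SL(2, ℝ)))).map
      (toGL : SL(2, ℝ) →* GL (Fin 2) ℝ)).IsArithmetic] :
    ProperlyDiscontinuousSMul Γ ℍ := by
  set A : Subgroup (GL (Fin 2) ℝ) := ((Γ.comap (QuotientGroup.mk' (Subgroup.center SL(2, ℝ)))).map
      (toGL : SL(2, ℝ) →* GL (Fin 2) ℝ)) with hA_def
  rw [Subgroup.properlyDiscontinuousSMul_iff]
  intro K L hK hL
  have hPD : ProperlyDiscontinuousSMul A ℍ := inferInstance
  have hfinA := (Subgroup.properlyDiscontinuousSMul_iff A).mp hPD hK hL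
  -- the lifts `t ∈ π⁻¹ Γ̄` moving `K` into `L` inject into that finite set by `toGL`
  have hfinT : {t : SL(2, ℝ) | t ∈ Γ.comap (QuotientGroup.mk' (Subgroup.center SL(2, ℝ))) ∧
      (t • K ∩ L).Nonempty}.Finite := by
    refine (hfinA.preimage Matrix.SpecialLinearGroup.toGL_injective.injOn).subset ?_
    rintro t ⟨ht, hne⟩
    refine ⟨Subgroup.mem_map.mpr ⟨t, ht, rfl⟩, ?_⟩
    have hset : (toGL t : GL (Fin 2) ℝ) • K = t • K := by
      ext τ
      simp only [Set.mem_smul_set, sl_smul_eq_toGL_smul]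
    change ((toGL t : GL (Fin 2) ℝ) • K ∩ L).Nonempty
    rwa [hset]
  -- and surject onto the `q ∈ Γ̄` moving `K` into `L` by `π`
  refine (hfinT.image (QuotientGroup.mk' (Subgroup.center SL(2, ℝ)))).subset ?_
  rintro q ⟨hq, hne⟩
  obtain ⟨t, rfl⟩ := QuotientGroup.mk_surjective q
  refine ⟨t, ⟨hq, ?_⟩, rfl⟩
  have hset : (QuotientGroup.mk t : PSL2R) • K = t • K := by
    ext τ
    simp only [Set.mem_smul_set, psl_mk_smul]
  rwa [hset] at hne

end HolRS

end Literature.AnabelianGeometry.AbsoluteAnabelian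

end
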